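import Literature.NumberTheory.LFunctions.RiemannXi
import HarnessLib

/-!
# Lagarias' Hermite–Biehler inequality for the shifted `ξ`-function (Lagarias 2005, Lemma 2.1)

Topic `Literature/NumberTheory/LFunctions`, next to `RiemannXi.lean`
(`riemannXi s = ξ(s) = ½ s(s−1) π^{-s/2} Γ(s/2) ζ(s)`). Named fact (D-0014; nothing asserted) for
route `RiemannHypothesis/DeBrangesShift`: it is the Hermite–Biehler hypothesis of de Branges'
positivity theorem (`Literature.Analysis.DeBrangesSpaces.conreyLi2000_thm1`, PROVED in the tree as
`conreyLi2000_thm1_holds`) for the whole shift family `E_c(z) = ξ(1/2 + c − 2icz)`, `c ≥ 1/2`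
(grounds `Summit.RiemannHypothesis.RiemannHypothesis.Theses.DeBrangesShift.Assembly` and
`….KernelNecessity`).

J. C. Lagarias, *Zero spacing distributions for differenced L-functions*, Acta Arith. 120 (2005)
159–184 = arXiv:math/0601653, §2, **Lemma 2.1** (read, arXiv version p. 4), verbatim:

> **Lemma 2.1.** (1) If `h ≥ 1/2`, then `|ξ(h + s)| > |ξ(h + 1 − s̄)|` for `Re(s) > 1/2`.
> (2) Assuming the Riemann hypothesis, the inequality holds for each `h > 0`.

(proof: term by term in the modified Hadamard product for `ξ`), restated in §6 as

> **Lemma 6.1.** (i) For `h ≥ 1/2` the function `E_h(z) := ξ(1/2 + h − iz)` is a de Branges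
> structure function, i.e. `|E_h(z)| > |E_h(z̄)|` when `Im(z) > 0`. (ii) If the Riemann hypothesis
> holds, then for all `h ≠ 0` the function `E_h(z)` is a de Branges structure function.

Only the unconditional part (1)/(i) is recorded (`lagarias2005_lemma_2_1`), plus its restatement
`lagarias2005_lemma_2_1.structureFunction` in the `z`-variable (pure algebra from the fact). The
tree can in fact PROVE the fact (Hadamard product of `ξ` through
`Literature.NumberTheory.LFunctions.exists_isHadamardSeq` / `riemannXi_eq_deBruijnH` and the
term-by-term comparison of Lagarias' proof) — left to a literature-prover; the related NON-strict
inequality `‖ξ(w − 1)‖ ≤ ‖ξ(w)‖`, `1 ≤ Re w ≤ 10`, is already proved in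
`RiemannXiShiftInequality.lean` (Lagarias–Suzuki 2006, Thm. 2.1).

## References

* J. C. Lagarias, Acta Arith. 120 (2005) 159–184 = arXiv:math/0601653, Lemma 2.1, Lemma 6.1
  [Lagarias2005].
* J. B. Conrey, X.-J. Li, IMRN 2000 = arXiv:math/9812166, Theorem 1 [ConreyLi2000].
-/

noncomputable section

open Complex
open scoped ComplexConjugate

namespace Literature.NumberTheory.LFunctions

/-- NAMED FACT (**Lagarias 2005, Lemma 2.1 (1)**): for every real `h ≥ 1/2` and every `s` with
`Re s > 1/2`, `|ξ(h + s)| > |ξ(h + 1 − s̄)|`. Users take `(hL : lagarias2005_lemma_2_1)`.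
[cite: Lagarias2005, Lemma 2.1] -/
def lagarias2005_lemma_2_1 : Prop :=
  ∀ h : ℝ, 1 / 2 ≤ h → ∀ s : ℂ, 1 / 2 < s.re →
    ‖riemannXi (h + 1 - conj s)‖ < ‖riemannXi (h + s)‖

/-- **Lagarias 2005, Lemma 6.1 (i)** as a consequence of the fact: for `h ≥ 1/2`,
`E_h(z) = ξ(1/2 + h − iz)` is a de Branges structure function, `|E_h(z̄)| < |E_h(z)|` for
`Im z > 0` (put `s = 1/2 − iz`, so `Re s = 1/2 + Im z > 1/2`, `h + s = 1/2 + h − iz` and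
`h + 1 − s̄ = 1/2 + h − i z̄`). [cite: Lagarias2005, Lemma 6.1] -/
theorem lagarias2005_lemma_2_1.structureFunction (hL : lagarias2005_lemma_2_1) {h : ℝ}
    (hh : 1 / 2 ≤ h) {z : ℂ} (hz : 0 < z.im) :
    ‖riemannXi (1 / 2 + h - I * conj z)‖ < ‖riemannXi (1 / 2 + h - I * z)‖ := by
  have hs : (1 / 2 : ℝ) < ((1 / 2 : ℂ) - I * z).re := by simp [hz]
  have key := hL h hh ((1 / 2 : ℂ) - I * z) hs
  have e1 : (h : ℂ) + 1 - conj ((1 / 2 : ℂ) - I * z) = 1 / 2 + h - I * conj z := by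
    simp only [map_sub, map_mul, Complex.conj_I, map_div₀, map_one, map_ofNat]
    ring
  have e2 : (h : ℂ) + ((1 / 2 : ℂ) - I * z) = 1 / 2 + h - I * z := by ring
  rwa [e1, e2] at key

/-- The route's rescaled family: for `c ≥ 1/2`, `E_c(z) = ξ(1/2 + c − 2icz)` satisfies
`|E_c(z̄)| < |E_c(z)|` on `Im z > 0` (apply the previous statement at `2cz`, whose imaginary part
is `2c·Im z > 0`). [cite: Lagarias2005, Lemma 6.1] -/
theorem lagarias2005_lemma_2_1.structureFunction_scaled (hL : lagarias2005_lemma_2_1) {c : ℝ}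
    (hc : 1 / 2 ≤ c) {z : ℂ} (hz : 0 < z.im) :
    ‖riemannXi (1 / 2 + c - 2 * c * I * conj z)‖ < ‖riemannXi (1 / 2 + c - 2 * c * I * z)‖ := by
  have hc0 : (0 : ℝ) < c := by linarith
  have hz' : 0 < ((2 * c : ℂ) * z).im := by
    have : ((2 * c : ℂ) * z).im = 2 * c * z.im := by simp
    rw [this]; positivity
  have key := lagarias2005_lemma_2_1.structureFunction hL hc (z := (2 * c : ℂ) * z) hz'
  have e1 : I * conj ((2 * c : ℂ) * z) = 2 * c * I * conj z := by
    simp only [map_mul, map_ofNat, Complex.conj_ofReal]; ring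
  have e2 : I * ((2 * c : ℂ) * z) = 2 * c * I * z := by ring
  rwa [e1, e2] at key

end Literature.NumberTheory.LFunctions
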